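import Literature.Barriers.HodgeConjecture.GeneralizedHodgeTrivialReasonsEllipticCurveCubedTorus
import Literature.Barriers.HodgeConjecture.GeneralizedHodgeTrivialReasonsFiltOne
import Literature.LinearAlgebra.Alternating.WedgeWordsBasis
import Mathlib.LinearAlgebra.FiniteDimensional.Lemmas
import HarnessLib

/-!
# `b₃(E_τ³) = 20` on the de Rham side: the twenty lattice `3`-forms are a basis of `H³_dR(ℂ³/(ℤ+τℤ)³)`

Companion of `GeneralizedHodgeTrivialReasonsEllipticCurveCubedTorus` (the torus `ℂ³/(ℤ + τℤ)³`, its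
lattice frame `ε a i = dx_{(a,i)}` and the Hodge pieces of `H³_dR`) and of
`Literature/LinearAlgebra/Alternating/WedgeWordsBasis.lean` (increasing monomials of a dual frame are
a basis). Lange–Birkenhake (1992), §1.1.4 Prop. 1.1.20: "the classes of the `n`-forms
`dx_{i₁} ∧ ⋯ ∧ dx_{iₙ}`, `i₁ < ⋯ < iₙ`, form a basis of `Hⁿ(X, ℂ)`", Exercise 1.1.6 (8): "rank
`C(2g, n)`" — here `g = 3`, `n = 3`, `C(6,3) = 20`, on the DE RHAM side of the torus, and in the
indexing of the named fact: the twenty forms `latticeKunnethForm ε = kunnethFamily (transversalForm ε)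
(mixedForm ε)` (form-level twin of `kunnethFamily (transversal e) (mixed e)` of
`GeneralizedHodgeTrivialReasonsCupProducts`) are, up to the signs of `kunnethFamily`, the increasing
monomials of the lattice frame for the lexicographic order on `Fin 3 × Fin 2`
(`latticeKunnethForm_eq_smul_frameWord`), hence

* `latticeKunnethFormBasis`: a `ℂ`-basis of `Alt³_ℝ(E; ℂ)` for any dual frame, `finrank = 20`;
* `finrank_complexDeRham_three_ellipticCurveCubedTorus`: `dim_ℂ H³_dR(ℂ³/(ℤ+τℤ)³; ℂ) = 20`, with the
  basis `cconstClass ∘ latticeKunnethForm (latFrame τ)` (`deRhamKunnethBasis`) — the de Rham twin of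
  clauses (2)–(3) of `Grothendieck1969_ellipticCurveCubed_hodgeDecomposition`.

## References

* H. Lange, Ch. Birkenhake, *Complex Abelian Varieties* (1992), §1.1.4 Prop. 1.1.20, Exercise
  1.1.6 (8) (held copy, PDF pp. 24, 27). [LangeBirkenhake1992]
-/

noncomputable section

open scoped ComplexConjugate
open Complex Function ContinuousAlternatingMap
open Literature.LinearAlgebra.Alternating Literature.Analysis.Complex Literature.Geometry.Kaehler
open Literature.NumberTheory.Transcendental

namespace Literature.Barriers.HodgeConjecture

variable {E : Type*} [NormedAddCommGroup E] [NormedSpace ℂ E]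

/-! ### The twenty lattice `3`-forms -/

/-- **Mixed lattice forms** `ε_{a,0} ∧ ε_{a,1} ∧ ε_{d,i}` in factor order, `d = a.succAbove k`
(twin of `mixed`). [cite: LangeBirkenhake1992, §1.1.4 Prop. 1.1.20] -/
def mixedForm (ε : Fin 3 → Fin 2 → (E →L[ℝ] ℂ)) (a : Fin 3) (k i : Fin 2) : E [⋀^Fin 3]→L[ℝ] ℂ :=
  mixedCupForm ε a k (ε (a.succAbove k) i)

/-- **The twenty lattice `3`-forms** `dx_I`, `#I = 3`, ordered and signed as `kunnethFamily`
(twin of `kunnethFamily (transversal e) (mixed e)`). [cite: LangeBirkenhake1992, §1.1.4 Prop. 1.1.20] -/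
def latticeKunnethForm (ε : Fin 3 → Fin 2 → (E →L[ℝ] ℂ)) : Fin 20 → E [⋀^Fin 3]→L[ℝ] ℂ :=
  kunnethFamily (transversalForm ε) (mixedForm ε)

/-- The increasing word (lexicographic order on `Fin 3 × Fin 2`) of the `j`-th lattice form.
[cite: LangeBirkenhake1992, §1.1.4 Prop. 1.1.20] -/
def kunnethWord : Fin 20 → Fin 3 → Lex (Fin 3 × Fin 2) :=
  ![![toLex (0, 1), toLex (1, 1), toLex (2, 1)], ![toLex (0, 0), toLex (1, 1), toLex (2, 1)],
    ![toLex (0, 1), toLex (1, 0), toLex (2, 1)], ![toLex (0, 1), toLex (1, 1), toLex (2, 0)],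
    ![toLex (0, 1), toLex (1, 0), toLex (2, 0)], ![toLex (0, 0), toLex (1, 1), toLex (2, 0)],
    ![toLex (0, 0), toLex (1, 0), toLex (2, 1)], ![toLex (0, 0), toLex (1, 0), toLex (2, 0)],
    ![toLex (0, 0), toLex (0, 1), toLex (1, 0)], ![toLex (0, 0), toLex (0, 1), toLex (1, 1)],
    ![toLex (0, 0), toLex (0, 1), toLex (2, 0)], ![toLex (0, 0), toLex (0, 1), toLex (2, 1)],
    ![toLex (0, 0), toLex (1, 0), toLex (1, 1)], ![toLex (0, 1), toLex (1, 0), toLex (1, 1)],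
    ![toLex (1, 0), toLex (1, 1), toLex (2, 0)], ![toLex (1, 0), toLex (1, 1), toLex (2, 1)],
    ![toLex (0, 0), toLex (2, 0), toLex (2, 1)], ![toLex (0, 1), toLex (2, 0), toLex (2, 1)],
    ![toLex (1, 0), toLex (2, 0), toLex (2, 1)], ![toLex (1, 1), toLex (2, 0), toLex (2, 1)]]

/-- The signs of `kunnethFamily`: `-1` at `1, 2, 3, 7`. [cite: LangeBirkenhake1992, §1.1.4 Prop. 1.1.20] -/
def kunnethSign : Fin 20 → ℂˣ :=
  ![1, -1, -1, -1, 1, 1, 1, -1, 1, 1, 1, 1, 1, 1, 1, 1, 1, 1, 1, 1]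

/-- The Künneth words are strictly increasing. [folklore] -/
theorem strictMono_kunnethWord : ∀ j, StrictMono (kunnethWord j) := by
  unfold kunnethWord StrictMono
  decide

/-- The Künneth words are pairwise distinct. [folklore] -/
theorem injective_kunnethWord : Injective kunnethWord := by
  unfold kunnethWord Injective
  decide

set_option maxRecDepth 16000 in
/-- There are exactly `C(6,3) = 20` increasing words of length `3` over `Fin 3 × Fin 2`. [folklore] -/
theorem card_strictMono_three :
    Fintype.card {w : Fin 3 → Lex (Fin 3 × Fin 2) // StrictMono w} = 20 := by
  unfold StrictMono
  decide

section Frame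

variable (θ₀ : Lex (Fin 3 × Fin 2) → (E →L[ℝ] ℝ))

/-- The complexified frame `ε a i = θ_{(a,i)} · 1`. [folklore] -/
def frameOf (a : Fin 3) (i : Fin 2) : E →L[ℝ] ℂ := (θ₀ (toLex (a, i))).smulRight (1 : ℂ)

/-- `(1 : ℂˣ) • W = W` on `Alt³` (the `module`-normalising form; `one_smul` does not fire through
the `ContinuousAlternatingMap` scalar instance by `rw`). [folklore] -/
theorem units_one_smul_alt (W : E [⋀^Fin 3]→L[ℝ] ℂ) : ((1 : ℂˣ) : ℂ) • W = W := by
  rw [Units.val_one]; module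

/-- `(-1 : ℂˣ) • W = -W` on `Alt³`. [folklore] -/
theorem units_neg_one_smul_alt (W : E [⋀^Fin 3]→L[ℝ] ℂ) : ((-1 : ℂˣ) : ℂ) • W = -W := by
  rw [Units.val_neg, Units.val_one]; module

/-- **The lattice forms are the signed increasing monomials**:
`latticeKunnethForm ε j = sign j • (θ_{w_j 0} ∧ θ_{w_j 1} ∧ θ_{w_j 2} ∧ 1)` for `ε a i = θ_{(a,i)} · 1`.
[cite: LangeBirkenhake1992, §1.1.4 Prop. 1.1.20] -/
theorem latticeKunnethForm_eq_smul_frameWord (j : Fin 20) :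
    latticeKunnethForm (frameOf θ₀) j = (kunnethSign j : ℂ) • frameWord ℂ θ₀ 3 (kunnethWord j) := by
  fin_cases j <;>
    simp only [latticeKunnethForm, kunnethFamily, kunnethSign, kunnethWord, Fin.zero_eta, Fin.mk_one,
      Fin.reduceFinMk, Fin.isValue, Matrix.cons_val_zero, Matrix.cons_val_one, Matrix.cons_val] <;>
    first
    | (rw [units_one_smul_alt]; rfl)
    | (rw [units_neg_one_smul_alt]; rfl)

variable (v : Lex (Fin 3 × Fin 2) → E) (hdual : ∀ p q, θ₀ p (v q) = if p = q then 1 else 0)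

include hdual in
/-- **The twenty lattice forms are linearly independent** (dual frame). [cite: LangeBirkenhake1992, §1.1.4 Prop. 1.1.20] -/
theorem linearIndependent_latticeKunnethForm :
    LinearIndependent ℂ (latticeKunnethForm (frameOf θ₀) (E := E)) := by
  have h := (linearIndependent_frameWord_strictMono (𝕜' := ℂ) θ₀ v hdual 3).comp
    (fun j ↦ ⟨kunnethWord j, strictMono_kunnethWord j⟩)
    (fun j j' hjj' ↦ injective_kunnethWord (congrArg Subtype.val hjj'))
  have h' := h.units_smul kunnethSign
  have hfun : latticeKunnethForm (frameOf θ₀) (E := E) =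
      kunnethSign • ((fun w : {w : Fin 3 → Lex (Fin 3 × Fin 2) // StrictMono w} ↦
        frameWord ℂ θ₀ (E := E) 3 w.1) ∘ fun j ↦ ⟨kunnethWord j, strictMono_kunnethWord j⟩) := by
    funext j
    rw [latticeKunnethForm_eq_smul_frameWord θ₀ j, Pi.smul_apply', comp_apply, Units.smul_def]
  rw [hfun]
  exact h'

variable (hframe : ∑ p, (θ₀ p).smulRight (v p) = ContinuousLinearMap.id ℝ E)

include hdual hframe in
/-- `dim_ℂ Alt³_ℝ(E; ℂ) = 20` for a dual frame indexed by `Fin 3 × Fin 2`. [cite: LangeBirkenhake1992, §1.1.4 Prop. 1.1.20 and Exercise 1.1.6 (8)] -/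
theorem finrank_alt_three_eq : Module.finrank ℂ (E [⋀^Fin 3]→L[ℝ] ℂ) = 20 := by
  rw [finrank_eq_card_strictMono (𝕜' := ℂ) θ₀ v hdual hframe 3, card_strictMono_three]

include hdual hframe in
/-- **The basis of the twenty lattice `3`-forms** of `Alt³_ℝ(E; ℂ)`. [cite: LangeBirkenhake1992, §1.1.4 Prop. 1.1.20] -/
def latticeKunnethFormBasis : Module.Basis (Fin 20) ℂ (E [⋀^Fin 3]→L[ℝ] ℂ) :=
  haveI : FiniteDimensional ℂ (E [⋀^Fin 3]→L[ℝ] ℂ) :=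
    Module.Finite.of_basis (frameWordBasis (𝕜' := ℂ) θ₀ v hdual hframe 3)
  basisOfLinearIndependentOfCardEqFinrank (linearIndependent_latticeKunnethForm θ₀ v hdual)
    (by rw [Fintype.card_fin, finrank_alt_three_eq θ₀ v hdual hframe])

include hdual hframe in
/-- The basis vectors are the lattice forms. [cite: LangeBirkenhake1992, §1.1.4 Prop. 1.1.20] -/
@[simp] theorem coe_latticeKunnethFormBasis :
    ⇑(latticeKunnethFormBasis θ₀ v hdual hframe) = latticeKunnethForm (frameOf θ₀) := by
  rw [latticeKunnethFormBasis]
  exact Module.Basis.coe_mk _ _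

end Frame

/-! ### On the torus `ℂ³/(ℤ + τℤ)³` -/

section Torus

variable (τ : ℂ) (hτ : τ.im ≠ 0)

/-- The lattice coordinate frame of `Φ_τ`, indexed lexicographically. [cite: LangeBirkenhake1992, §1.1.4] -/
def latCoordLex (p : Lex (Fin 3 × Fin 2)) : (Fin 3 → ℂ) →L[ℝ] ℝ :=
  ComplexTorus.coord (periodIso τ hτ) (ofLex p)

/-- The lattice basis vectors `λ_{(a,0)} = e_a`, `λ_{(a,1)} = τ e_a`, indexed lexicographically.
[cite: LangeBirkenhake1992, §1.1.1] -/
def latVecLex (p : Lex (Fin 3 × Fin 2)) : Fin 3 → ℂ :=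
  periodIso τ hτ (Pi.single (ofLex p) 1)

/-- The lattice frame of `…EllipticCurveCubedTorus` is the complexified coordinate frame.
[cite: LangeBirkenhake1992, §1.1.4] -/
theorem latFrame_eq_frameOf : latFrame τ hτ = frameOf (latCoordLex τ hτ) := by
  funext a i
  ext z
  simp only [latFrame_apply, frameOf, ContinuousLinearMap.smulRight_apply, latCoordLex, ofLex_toLex,
    ComplexTorus.coord_apply, Complex.real_smul, mul_one]

/-- Duality `x_p(λ_q) = δ_{pq}`. [cite: LangeBirkenhake1992, §1.1.4 Prop. 1.1.20] -/
theorem latCoordLex_latVecLex (p q : Lex (Fin 3 × Fin 2)) :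
    latCoordLex τ hτ p (latVecLex τ hτ q) = if p = q then 1 else 0 := by
  rw [latCoordLex, latVecLex, ComplexTorus.coord_apply_single]
  simp only [ofLex_inj]

/-- The coordinate frame is a dual frame: `Σ_p x_p(·) λ_p = id`. [cite: LangeBirkenhake1992, §1.1.4] -/
theorem sum_latCoordLex_smulRight_latVecLex :
    ∑ p, (latCoordLex τ hτ p).smulRight (latVecLex τ hτ p) = ContinuousLinearMap.id ℝ (Fin 3 → ℂ) := by
  refine ContinuousLinearMap.ext fun z ↦ ?_
  rw [_root_.sum_apply, ContinuousLinearMap.coe_id', id_eq]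
  simp only [ContinuousLinearMap.smulRight_apply, latCoordLex, latVecLex, ComplexTorus.coord_apply]
  rw [← Equiv.sum_comp (toLex : Fin 3 × Fin 2 ≃ Lex (Fin 3 × Fin 2))]
  simp only [ofLex_toLex, ← map_smul]
  rw [← _root_.map_sum]
  conv_rhs => rw [← (periodIso τ hτ).apply_symm_apply z]
  congr 1
  conv_rhs => rw [← Finset.univ_sum_single ((periodIso τ hτ).symm z)]
  refine Finset.sum_congr rfl fun q _ ↦ ?_
  rw [← Pi.single_smul, smul_eq_mul, mul_one]

/-- **`dim_ℂ H³_dR(ℂ³/(ℤ + τℤ)³; ℂ) = 20 = C(6,3)`** (Lange–Birkenhake Prop. 1.1.20, Exercise 1.1.6 (8),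
de Rham side). [cite: LangeBirkenhake1992, §1.1.4 Prop. 1.1.20 and Exercise 1.1.6 (8)] -/
theorem finrank_complexDeRham_three_ellipticCurveCubedTorus :
    Module.finrank ℂ (complexDeRhamCohomology (Fin 3 → ℂ) (EllipticCurveCubedTorus τ hτ) 3) = 20 := by
  rw [← (ComplexTorus.cconstClassEquiv (periodIso τ hτ) (k := 3)).finrank_eq,
    finrank_alt_three_eq (latCoordLex τ hτ) (latVecLex τ hτ) (latCoordLex_latVecLex τ hτ)
      (sum_latCoordLex_smulRight_latVecLex τ hτ)]

/-- **The de Rham Künneth basis of `H³_dR(ℂ³/(ℤ + τℤ)³; ℂ)`**: the classes of the twenty lattice forms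
`dx_I`, ordered and signed as `kunnethFamily` (de Rham twin of clauses (2)–(3) of
`Grothendieck1969_ellipticCurveCubed_hodgeDecomposition`). [cite: LangeBirkenhake1992, §1.1.4 Prop. 1.1.20] -/
def deRhamKunnethBasis :
    Module.Basis (Fin 20) ℂ (complexDeRhamCohomology (Fin 3 → ℂ) (EllipticCurveCubedTorus τ hτ) 3) :=
  (latticeKunnethFormBasis (latCoordLex τ hτ) (latVecLex τ hτ) (latCoordLex_latVecLex τ hτ)
    (sum_latCoordLex_smulRight_latVecLex τ hτ)).map (ComplexTorus.cconstClassEquiv (periodIso τ hτ))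

/-- The basis vectors are the classes of the lattice forms of the lattice frame.
[cite: LangeBirkenhake1992, §1.1.4 Prop. 1.1.20] -/
theorem deRhamKunnethBasis_apply (j : Fin 20) :
    deRhamKunnethBasis τ hτ j =
      ComplexTorus.cconstClass (periodIso τ hτ) (latticeKunnethForm (latFrame τ hτ) j) := by
  rw [deRhamKunnethBasis, Module.Basis.map_apply, coe_latticeKunnethFormBasis, latFrame_eq_frameOf]
  rfl

end Torus

end Literature.Barriers.HodgeConjecture

end
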